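import Summits.QuantumFields.BalabanUV.Beta.FP.CompositeAveragingTablesLetters

/-!
# `BalabanUV.Beta.FP.CompositeAveragingTablesMixedLetters` — road «FP» for binder row D1, row **N1-J∞-W PART 3(b)**, FILE D4 of the part: THE LETTERS OF THE COMPOSITE
# MIXED TABLES — every `M2Comp Lc q λ H M₂ cΛ m` is a LOCAL FIELD–MULTIPLIER TABLE at blocking `Lc^m` (`LocStencilFM (Lc^m) (M2Comp … m) C_m δ_m`), from the decay letter
# of the one-step weight `q`, the vertex-family letter of the one-step Hessian table `H` and the `LocStencilFM` letter of the one-step mixed table `M₂`, by induction on `m`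
# through the four families of the third-order chain rule (FILE D1 §3) and FILE D3's letters

HONEST DEPENDENCY (page 1, mandatory): continuum YM on T⁴ ⇐ BetaPertH ∧ nine spine estimates (0/9 proved); BetaPertH ⇐ (D1) ∧ (D4) ∧ CAP+tail;
G-an2-4 gates asym, D1 and NE2/3/4.  HONEST FRAMING (cell contract, verbatim): «discharging `BetaPertH` makes Bałaban's UV stability UNCONDITIONAL —
a real constructive-QFT result; it is NOT the continuum limit and NOT the Clay problem.»  ABSOLUTE RULE (cell charter, verbatim): «No internally-minted
statement may enter as a cited fact. Every hypothesis is either kernel-proved in this package or a verbatim quotation of a PUBLISHED theorem with page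
reference. The manuscript(s) under audit are NOT citable for their own disputed steps — they are the thing under adjudication; programme-internal
(2001/route/tribunal) claims are never citable.»  THIS MODULE is [folklore] kernel bookkeeping (exponentially localised lattice sums; no `def`, no `def … : Prop`,
nothing cited, 0 sorry).  The three input letters are HYPOTHESIS SHAPES with free constants, asserted for no object of Bałaban's: (Lq) `|q ρ w κ u| ≤ Cq·e^{−δ|u − Lc•w|₁}`,
(LH) `VertexFamily H Lc CH δ`, (LM) `LocStencilFM Lc M₂ CM δ` (ONE rate `δ`: equalise beforehand by `biLoc_mono` ∕ `LocStencilFM.mono`).  0∕4 row-D1 binders; NOT X1m,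
NOT (STEP), NOT D1, NOT BetaPertH, NOT continuum, NOT Clay.  «not in print; our bookkeeping».

WHY.  The END's extra-slot ∕ split rows for `m ≥ 2` read FILE D2's carrier `WtInf m = W2SymOfK (G m) (Lc^m) S∞ (MCompInf m) S₂∞ (M2CompInf m)` through an2's `vertexFamily₂`-lemmas,
which consume `VertexFamily (M m) (Lc^m)` (FILE D3) and `LocStencilFM (Lc^m) (M₂ m)` (THIS FILE; `M2CompInf = M2Comp … (qSym Lc) lamPerfect tabs.H (M2Sym tabs) cΛ`, so the END's
instance is `locStencilFM_M2Comp` fed with the perfect one-step letters — a one-line specialisation left to the consumer, who owns the displayed (Lq) for `qSym`).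

CONTENT ([folklore]; generic `d`, `Lc` with `NeZero Lc`).
* §1 TWO BRICKS: `biLoc_cwsum_farK` — coarse superposition whose KERNELS sit at their own coarse points `N•y` with constants decaying in `|N•y − P|₁` and whose weights decay from
  `p` ⟹ bi-localised at `p` with the far factor `e^{−(μ/2)|p − P|₁}` (the kernels' far factor is moved onto the weights entrywise, then an2's `biLoc_cwsum`);
  `biLoc_recenter_both` — `BiLoc K p p (C·e^{−a|u − p|₁}) r → BiLoc K u u (C·e^{−t|u − p|₁}) t`, `t = min (a/3) r` (a third of the far factor per leg, an2's `biLoc_recenter_left∕right`).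
* §2 THE FOUR FAMILIES of `M2Comp_succ_succ` at level `m+2`, one lemma each (`biLoc_family_hess` ∕ `_weights` ∕ `_lin` ∕ `_upper`: `∃ B r, 0 ≤ B ∧ 0 < r ∧ BiLoc (family) u u
  (B·e^{−r|u − Lc^{m+2}•w|₁}) r` from the level-`m+1` letters):
  (iii) `cwsum Lc (aComp (m+1) ρ w σ) (M₂ κ u σ)` by an2's `biLoc_cwsum_far` (FILE D3 §2's weights re-read at the coarse points, (LM)'s kernels at `u`);
  (ii) `cwsum Lc (v ↦ Σ_{σ′} Σ'_{v′} HComp (m+1) ρ w v v′ σ σ′ · q σ′ v′ κ u) (H σ)` — weights bounded by FILE D3 §1's convolution (a `u`-far factor times a decay from the coarse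
  bond), `biLoc_cwsum` at the coarse bond, then `biLoc_recenter_both`; (iv) `liftFH Lc q H κ u (HComp (m+1) ρ w)` by FILE D3's `biLoc_liftFH` on `vertexFamily_HComp`;
  (i) `cwsum Lc (q σ′ · κ u) (v′ ↦ liftF Lc q (M2Comp (m+1) σ′ v′ ρ w))` by FILE D3's `biLoc_liftF` (uniform in the lifted kernel) on the induction hypothesis, then §1's
  `biLoc_cwsum_farK`.
* §3 **`locStencilFM_M2Comp`**: `∀ m, ∃ C δ′, 0 < δ′ ∧ LocStencilFM (Lc^(m+1)) (M2Comp Lc q λ H M₂ cΛ (m+1)) C δ′` (induction; the four families at the common rate, `biLoc_finset_sum` ∕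
  `biLoc_smul` ∕ `biLoc_add`).  Rates degrade per level (minimum of the input rates over `Lc`, then ∕6) — no optimality claimed.
Provenance: D1 formalisation swarm LEAF PROVER 02, unit b2b-balaban-beta-d1-formalise-leaf-02 gen 13, 2026-08-21 (R-FP-44 (B)).  No existing file touched.
-/

noncomputable section

namespace Summit.QuantumFields.BalabanUV.Beta.FP.CompositeAveragingTablesMixedLetters

open Finset
open scoped BigOperators
open Literature.MathematicalPhysics.QuantumFieldTheory
open Literature.MathematicalPhysics.QuantumFieldTheory.Balaban1983to89
open Literature.MathematicalPhysics.QuantumFieldTheory.Balaban1983to89.Beta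
open B12Sec2to5 (l1 l1_nonneg)
open ExpKernelCalculus (MKer BiLoc VertexFamily Zl Zl_nonneg l1_sub_triangle l1_sub_symm)
open AffineAveraging (Site)
open OneStepResolventKernel (Fib biLoc_mono)
open InterLevelTransport (cwsum cwsum_apply biLoc_cwsum)
open KernelWard (biLoc_add biLoc_finset_sum)
open SecondOrderResponse (LocStencilFM biLoc_cwsum_far biLoc_recenter_left biLoc_recenter_right biLoc_smul)
open BalabanStepW2 (biLoc_le_mono)
open Summit.QuantumFields.BalabanUV.Beta.FP.CompositeAveragingTablesInf
open Summit.QuantumFields.BalabanUV.Beta.FP.CompositeAveragingTablesLetters (smul_pow_succ exp_index_eq abs_tsum_conv_le aComp_loc biLoc_far_mono biLoc_liftF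
  biLoc_liftFH vertexFamily_HComp)

variable {d : ℕ} {Lc : ℕ} [NeZero Lc]

/-! ## §1 Two bricks -/

section Bricks

variable {N : ℕ}

omit [NeZero Lc] in
/-- [folklore] **COARSE SUPERPOSITION, KERNELS AT THEIR OWN COARSE POINTS WITH A FAR FACTOR**: weights `|w y| ≤ Cw·e^{−μ|N•y − p|₁}`, kernels `Q y` bi-localised at `(N•y, N•y)`
(rate `μ`) with constants `Ck·e^{−μ|N•y − P|₁}` ⟹ `cwsum N w Q` is bi-localised at `(p, p)` (rate `μ/4`) with constant `Cw·Ck·Zl(μ/4)·e^{−(μ/2)|p − P|₁}` (move the kernels' far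
factor onto the weights entrywise — the superposition is unchanged — and split `μ|N•y − p|₁ + μ|N•y − P|₁ ≥ (μ/2)|N•y − p|₁ + (μ/2)|p − P|₁`; then an2's `biLoc_cwsum`). -/
theorem biLoc_cwsum_farK [NeZero N] {w : Site (d + 1) → ℝ} {Q : Site (d + 1) → MKer (d + 1) (Fib d)} {Cw Ck μ : ℝ} {p P : Site (d + 1)}
    (hw : ∀ y, |w y| ≤ Cw * Real.exp (-μ * l1 ((N : ℤ) • y - p)))
    (hQ : ∀ y, BiLoc (Q y) ((N : ℤ) • y) ((N : ℤ) • y) (Ck * Real.exp (-μ * l1 ((N : ℤ) • y - P))) μ)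
    (hμ : 0 < μ) (hCw : 0 ≤ Cw) (hCk : 0 ≤ Ck) :
    BiLoc (cwsum N w Q) p p (Cw * Ck * Zl (d + 1) (μ / 4) * Real.exp (-(μ / 2) * l1 (p - P))) (μ / 4) := by
  set w' : Site (d + 1) → ℝ := fun y => w y * Real.exp (-μ * l1 ((N : ℤ) • y - P)) with hw'
  set Q' : Site (d + 1) → MKer (d + 1) (Fib d) := fun y => Real.exp (μ * l1 ((N : ℤ) • y - P)) • Q y with hQ'
  have e : cwsum N w Q = cwsum N w' Q' := by
    funext x z a b
    rw [cwsum_apply, cwsum_apply]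
    refine tsum_congr fun y => ?_
    simp only [hw', hQ', Pi.smul_apply, smul_eq_mul]
    rw [mul_assoc, ← mul_assoc (Real.exp _) (Real.exp _), ← Real.exp_add, neg_mul, neg_add_cancel, Real.exp_zero, one_mul]
  have hw'' : ∀ y, |w' y| ≤ Cw * Real.exp (-(μ / 2) * l1 (p - P)) * Real.exp (-(μ / 2) * l1 ((N : ℤ) • y - p)) := by
    intro y
    simp only [hw']
    rw [abs_mul, abs_of_pos (Real.exp_pos _)]
    refine (mul_le_mul_of_nonneg_right (hw y) (Real.exp_pos _).le).trans ?_
    rw [mul_assoc, mul_assoc, ← Real.exp_add, ← Real.exp_add]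
    refine mul_le_mul_of_nonneg_left (Real.exp_le_exp.2 ?_) hCw
    have ht := l1_sub_triangle p ((N : ℤ) • y) P
    rw [l1_sub_symm p ((N : ℤ) • y)] at ht
    nlinarith [l1_nonneg ((N : ℤ) • y - p), l1_nonneg ((N : ℤ) • y - P)]
  have hQ'' : ∀ y, BiLoc (Q' y) ((N : ℤ) • y) ((N : ℤ) • y) Ck (μ / 2) := by
    intro y
    refine biLoc_mono (δ := μ) (fun x z a b => ?_) hCk (by linarith)
    simp only [hQ', Pi.smul_apply, smul_eq_mul]
    rw [abs_mul, abs_of_pos (Real.exp_pos _)]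
    refine (mul_le_mul_of_nonneg_left (hQ y x z a b) (Real.exp_pos _).le).trans (le_of_eq ?_)
    rw [← mul_assoc, ← mul_assoc, mul_comm (Real.exp _) Ck, mul_assoc Ck, ← Real.exp_add, neg_mul, add_neg_cancel, Real.exp_zero, mul_one]
  rw [e]
  have hE : 0 ≤ Cw * Real.exp (-(μ / 2) * l1 (p - P)) := by positivity
  have h := biLoc_cwsum hw'' hQ'' (half_pos hμ) hE
  have hZ := Zl_nonneg (D := d + 1) (show 0 < μ / 2 / 2 by positivity)
  rw [show μ / 2 / 2 = μ / 4 by ring] at h hZ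
  exact biLoc_le_mono h (by positivity) (le_of_eq (by ring)) le_rfl

omit [NeZero Lc] in
/-- [folklore] **RE-CENTRING BOTH LEGS ON A THIRD OF THE FAR FACTOR EACH**: `BiLoc K p p (C·e^{−a|u − p|₁}) r → BiLoc K u u (C·e^{−t|u − p|₁}) t` with `t = min (a/3) r` (an2's
`biLoc_recenter_left` then `biLoc_recenter_right`, after lowering the rate to `t`). -/
theorem biLoc_recenter_both {K : MKer (d + 1) (Fib d)} {p u : Site (d + 1)} {C a r : ℝ} (h : BiLoc K p p (C * Real.exp (-a * l1 (u - p))) r)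
    (hC : 0 ≤ C) (ha : 0 < a) (hr : 0 < r) :
    BiLoc K u u (C * Real.exp (-(min (a / 3) r) * l1 (u - p))) (min (a / 3) r) := by
  set t : ℝ := min (a / 3) r with ht
  have ht0 : 0 < t := lt_min (by positivity) hr
  have hta : 3 * t ≤ a := by have := min_le_left (a / 3) r; linarith
  have hL := l1_nonneg (u - p)
  have h1 : BiLoc K p p (((C * Real.exp (-t * l1 (u - p))) * Real.exp (-t * l1 (u - p))) * Real.exp (-t * l1 (u - p))) t := by
    refine biLoc_le_mono h (by positivity) ?_ (min_le_right _ _)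
    rw [mul_assoc, mul_assoc, ← Real.exp_add, ← Real.exp_add]
    exact mul_le_mul_of_nonneg_left (Real.exp_le_exp.2 (by nlinarith)) hC
  have h2 := biLoc_recenter_left h1 (by positivity) ht0.le le_rfl
  exact biLoc_recenter_right h2 (by positivity) ht0.le le_rfl

end Bricks

/-! ## §2 The four families of `M2Comp_succ_succ`, one lemma each (level `m+1 ↦ m+2`) -/

section Families

variable {q : Fin (d + 1) → Site (d + 1) → Fin (d + 1) → Site (d + 1) → ℝ} {Cq δ : ℝ}
  {H : Fin (d + 1) → Site (d + 1) → MKer (d + 1) (Fib d)} {CH : ℝ}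
  {M₂ : Fin (d + 1) → Site (d + 1) → Fin (d + 1) → Site (d + 1) → MKer (d + 1) (Fib d)} {CM : ℝ} {lam cΛ : ℝ} {m : ℕ}

/-- [folklore] **FAMILY (iii) — THE `U`-DERIVATIVE HITS THE ONE-STEP HESSIANS**: `cwsum Lc (aComp (m+1) ρ w σ) (M₂ κ u σ)` is bi-localised at `(u, u)` with a far factor in
`|u − Lc^{m+2}•w|₁` (FILE D3 §2's weights re-read at the coarse points, (LM)'s kernels at `u` with their far factor read from the coarse point; an2's `biLoc_cwsum_far`). -/
theorem biLoc_family_hess (hM₂ : LocStencilFM Lc M₂ CM δ) (hδ : 0 < δ) {A α : ℝ} (hA : 0 ≤ A) (hα : 0 < α)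
    (ha : ∀ ρ w κ u, |aComp q lam (m + 1) ρ w κ u| ≤ A * Real.exp (-α * l1 (u - ((Lc ^ (m + 1) : ℕ) : ℤ) • w))) :
    ∃ B r : ℝ, 0 ≤ B ∧ 0 < r ∧ ∀ (κ : Fin (d + 1)) (u : Site (d + 1)) (ρ : Fin (d + 1)) (w : Site (d + 1)) (σ : Fin (d + 1)),
      BiLoc (cwsum Lc (aComp q lam (m + 1) ρ w σ) (M₂ κ u σ)) u u (B * Real.exp (-r * l1 (u - ((Lc ^ (m + 2) : ℕ) : ℤ) • w))) r := by
  have hL : (0 : ℝ) < Lc := by exact_mod_cast Nat.pos_of_ne_zero (NeZero.ne Lc)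
  have hCM : 0 ≤ CM := hM₂.nonneg
  set s : ℝ := min (α / Lc) δ with hs
  have hs0 : 0 < s := lt_min (div_pos hα hL) hδ
  have hsα : s ≤ α / Lc := min_le_left _ _
  have hsδ : s ≤ δ := min_le_right _ _
  have hZ := Zl_nonneg (D := d + 1) (half_pos hs0)
  refine ⟨A * CM * Zl (d + 1) (s / 2), s / 2, by positivity, half_pos hs0, fun κ u ρ w σ => ?_⟩
  have hw : ∀ y, |aComp q lam (m + 1) ρ w σ y| ≤ A * Real.exp (-s * l1 ((Lc : ℤ) • y - ((Lc ^ (m + 2) : ℕ) : ℤ) • w)) := fun y => by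
    refine (ha ρ w σ y).trans (mul_le_mul_of_nonneg_left ?_ hA)
    rw [exp_index_eq (Lc := Lc) α y, smul_pow_succ]
    exact Real.exp_le_exp.2 (by nlinarith [l1_nonneg ((Lc : ℤ) • y - ((Lc ^ (m + 2) : ℕ) : ℤ) • w)])
  have hQ : ∀ y, BiLoc (M₂ κ u σ y) u u (CM * Real.exp (-s * l1 ((Lc : ℤ) • y - u))) δ := fun y => by
    have h := hM₂ κ u σ y
    rw [l1_sub_symm] at h
    exact biLoc_le_mono h (by positivity) (mul_le_mul_of_nonneg_left (Real.exp_le_exp.2 (by nlinarith [l1_nonneg ((Lc : ℤ) • y - u)])) hCM) le_rfl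
  exact biLoc_mono (biLoc_cwsum_far hw hQ hs0 hA hCM) (by positivity) (by linarith)

/-- [folklore] **FAMILY (ii) — IT HITS THE COMPOSITE WEIGHTS**: the weights `v ↦ Σ_{σ′} Σ'_{v′} HComp (m+1) ρ w v v′ σ σ′ · q σ′ v′ κ u` are bounded by FILE D3 §1's convolution (a
`u`-far factor times a decay from the coarse bond), so `cwsum Lc (…) (H σ)` is bi-localised at the coarse bond (an2's `biLoc_cwsum`) and then re-centred on `(u, u)` by §1's
`biLoc_recenter_both`. -/
theorem biLoc_family_weights (hq : ∀ ρ w κ u, |q ρ w κ u| ≤ Cq * Real.exp (-δ * l1 (u - (Lc : ℤ) • w))) (hCq : 0 ≤ Cq) (hδ : 0 < δ)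
    (hH : VertexFamily H Lc CH δ) {C₁ δ₁ : ℝ} (hδ₁ : 0 < δ₁) (hX : VertexFamily (HComp Lc q lam H (m + 1)) (Lc ^ (m + 1)) C₁ δ₁) :
    ∃ B r : ℝ, 0 ≤ B ∧ 0 < r ∧ ∀ (κ : Fin (d + 1)) (u : Site (d + 1)) (ρ : Fin (d + 1)) (w : Site (d + 1)) (σ : Fin (d + 1)),
      BiLoc (cwsum Lc (fun v => ∑ σ' : Fin (d + 1), ∑' v' : Site (d + 1), HComp Lc q lam H (m + 1) ρ w v v' (Sum.inl σ) (Sum.inl σ') * q σ' v' κ u) (H σ))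
        u u (B * Real.exp (-r * l1 (u - ((Lc ^ (m + 2) : ℕ) : ℤ) • w))) r := by
  haveI : NeZero (Lc ^ (m + 1)) := ⟨pow_ne_zero _ (NeZero.ne Lc)⟩
  have hL : (0 : ℝ) < Lc := by exact_mod_cast Nat.pos_of_ne_zero (NeZero.ne Lc)
  have hCH : 0 ≤ CH := (hH 0 0).nonneg (Sum.inl 0)
  have hC₁ : 0 ≤ C₁ := (hX 0 0).nonneg (Sum.inl 0)
  set s : ℝ := min (δ₁ / Lc) δ with hs
  have hs0 : 0 < s := lt_min (div_pos hδ₁ hL) hδ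
  have hs₁ : s ≤ δ₁ / Lc := min_le_left _ _
  have hsδ : s ≤ δ := min_le_right _ _
  have hZ := Zl_nonneg (D := d + 1) (half_pos hs0)
  refine ⟨(d + 1 : ℕ) * (C₁ * Cq * Zl (d + 1) (s / 2)) * CH * Zl (d + 1) (s / 2), s / 6, by positivity, by positivity, fun κ u ρ w σ => ?_⟩
  set W : Site (d + 1) := ((Lc ^ (m + 2) : ℕ) : ℤ) • w with hW
  have eW : (Lc : ℤ) • (((Lc ^ (m + 1) : ℕ) : ℤ) • w) = W := by rw [hW]; exact smul_pow_succ m w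
  have hw : ∀ v, |∑ σ' : Fin (d + 1), ∑' v' : Site (d + 1), HComp Lc q lam H (m + 1) ρ w v v' (Sum.inl σ) (Sum.inl σ') * q σ' v' κ u|
      ≤ ((d + 1 : ℕ) * (C₁ * Cq * Zl (d + 1) (s / 2)) * Real.exp (-(s / 2) * l1 (u - W))) * Real.exp (-s * l1 ((Lc : ℤ) • v - W)) := by
    intro v
    have hconv : ∀ σ' : Fin (d + 1), |∑' v' : Site (d + 1), HComp Lc q lam H (m + 1) ρ w v v' (Sum.inl σ) (Sum.inl σ') * q σ' v' κ u|
        ≤ C₁ * Real.exp (-s * l1 ((Lc : ℤ) • v - W)) * Cq * Zl (d + 1) (s / 2) * Real.exp (-(s / 2) * l1 (u - W)) := by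
      intro σ'
      have hav : ∀ v', |HComp Lc q lam H (m + 1) ρ w v v' (Sum.inl σ) (Sum.inl σ')|
          ≤ C₁ * Real.exp (-s * l1 ((Lc : ℤ) • v - W)) * Real.exp (-s * l1 ((Lc : ℤ) • v' - W)) := fun v' => by
        refine (hX ρ w v v' (Sum.inl σ) (Sum.inl σ')).trans ?_
        rw [mul_add, Real.exp_add, exp_index_eq (Lc := Lc) δ₁ v, exp_index_eq (Lc := Lc) δ₁ v', eW, ← mul_assoc]
        exact mul_le_mul (mul_le_mul_of_nonneg_left (Real.exp_le_exp.2 (by nlinarith [l1_nonneg ((Lc : ℤ) • v - W)])) hC₁)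
          (Real.exp_le_exp.2 (by nlinarith [l1_nonneg ((Lc : ℤ) • v' - W)])) (Real.exp_pos _).le (by positivity)
      have hg : ∀ v', |q σ' v' κ u| ≤ Cq * Real.exp (-s * l1 (u - (Lc : ℤ) • v')) := fun v' =>
        (hq σ' v' κ u).trans (mul_le_mul_of_nonneg_left (Real.exp_le_exp.2 (by nlinarith [l1_nonneg (u - (Lc : ℤ) • v')])) hCq)
      exact (abs_tsum_conv_le hav hg hs0 (by positivity) hCq).2
    refine (Finset.abs_sum_le_sum_abs _ _).trans ((Finset.sum_le_sum fun σ' _ => hconv σ').trans (le_of_eq ?_))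
    rw [Finset.sum_const, Finset.card_univ, Fintype.card_fin, nsmul_eq_mul]
    ring
  have hQ : ∀ y, BiLoc (H σ y) ((Lc : ℤ) • y) ((Lc : ℤ) • y) CH s := fun y => biLoc_mono (hH σ y) hCH hsδ
  have h0 := biLoc_cwsum hw hQ hs0 (by positivity)
  have h1 : BiLoc (cwsum Lc (fun v => ∑ σ' : Fin (d + 1), ∑' v' : Site (d + 1),
        HComp Lc q lam H (m + 1) ρ w v v' (Sum.inl σ) (Sum.inl σ') * q σ' v' κ u) (H σ)) W W
      (((d + 1 : ℕ) * (C₁ * Cq * Zl (d + 1) (s / 2)) * CH * Zl (d + 1) (s / 2)) * Real.exp (-(s / 2) * l1 (u - W))) (s / 2) :=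
    biLoc_le_mono h0 (by positivity) (le_of_eq (by ring)) le_rfl
  have h2 := biLoc_recenter_both h1 (by positivity) (half_pos hs0) (half_pos hs0)
  have e6 : min (s / 2 / 3) (s / 2) = s / 6 := by rw [min_eq_left (by linarith)]; ring
  rw [e6] at h2
  exact h2

/-- [folklore] **FAMILY (iv) — IT HITS THE LINEARISATION INSIDE THE LIFT**: `liftFH Lc q H κ u (HComp (m+1) ρ w)` by FILE D3's `biLoc_liftFH` on `vertexFamily_HComp`. -/
theorem biLoc_family_lin (hq : ∀ ρ w κ u, |q ρ w κ u| ≤ Cq * Real.exp (-δ * l1 (u - (Lc : ℤ) • w))) (hCq : 0 ≤ Cq) (hδ : 0 < δ)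
    (hH : VertexFamily H Lc CH δ) {C₁ δ₁ : ℝ} (hδ₁ : 0 < δ₁) (hX : VertexFamily (HComp Lc q lam H (m + 1)) (Lc ^ (m + 1)) C₁ δ₁) :
    ∃ B r : ℝ, 0 ≤ B ∧ 0 < r ∧ ∀ (κ : Fin (d + 1)) (u : Site (d + 1)) (ρ : Fin (d + 1)) (w : Site (d + 1)),
      BiLoc (liftFH Lc q H κ u (HComp Lc q lam H (m + 1) ρ w)) u u (B * Real.exp (-r * l1 (u - ((Lc ^ (m + 2) : ℕ) : ℤ) • w))) r := by
  obtain ⟨K, r, hK, hr, hlift⟩ := biLoc_liftFH (Lc := Lc) hq hCq hδ hH hδ₁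
  have hC₁ : 0 ≤ C₁ := (hX 0 0).nonneg (Sum.inl 0)
  refine ⟨K * C₁, r, by positivity, hr, fun κ u ρ w => ?_⟩
  have h := hlift (HComp Lc q lam H (m + 1) ρ w) (((Lc ^ (m + 1) : ℕ) : ℤ) • w) C₁ κ u (hX ρ w)
  rwa [smul_pow_succ] at h

/-- [folklore] **FAMILY (i) — IT HITS THE UPPER HESSIAN**: `cwsum Lc (q σ′ · κ u) (v′ ↦ liftF Lc q (M2Comp (m+1) σ′ v′ ρ w))` by FILE D3's `biLoc_liftF` (uniform in the lifted
kernel) on the induction hypothesis, then §1's `biLoc_cwsum_farK`. -/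
theorem biLoc_family_upper (hq : ∀ ρ w κ u, |q ρ w κ u| ≤ Cq * Real.exp (-δ * l1 (u - (Lc : ℤ) • w))) (hCq : 0 ≤ Cq) (hδ : 0 < δ)
    {C₂ δ₂ : ℝ} (hδ₂ : 0 < δ₂) (hIH : LocStencilFM (Lc ^ (m + 1)) (M2Comp Lc q lam H M₂ cΛ (m + 1)) C₂ δ₂) :
    ∃ B r : ℝ, 0 ≤ B ∧ 0 < r ∧ ∀ (κ : Fin (d + 1)) (u : Site (d + 1)) (ρ : Fin (d + 1)) (w : Site (d + 1)) (σ' : Fin (d + 1)),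
      BiLoc (cwsum Lc (fun v' => q σ' v' κ u) (fun v' => liftF Lc q (M2Comp Lc q lam H M₂ cΛ (m + 1) σ' v' ρ w))) u u
        (B * Real.exp (-r * l1 (u - ((Lc ^ (m + 2) : ℕ) : ℤ) • w))) r := by
  obtain ⟨K, r, hK, hr, hlift⟩ := biLoc_liftF (Lc := Lc) hq hCq hδ hδ₂
  have hL : (0 : ℝ) < Lc := by exact_mod_cast Nat.pos_of_ne_zero (NeZero.ne Lc)
  have hC₂ : 0 ≤ C₂ := hIH.nonneg
  set μ : ℝ := min (min δ (δ₂ / Lc)) r with hμ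
  have hμ0 : 0 < μ := lt_min (lt_min hδ (div_pos hδ₂ hL)) hr
  have hμδ : μ ≤ δ := (min_le_left _ _).trans (min_le_left _ _)
  have hμ₂ : μ ≤ δ₂ / Lc := (min_le_left _ _).trans (min_le_right _ _)
  have hμr : μ ≤ r := min_le_right _ _
  have hZ := Zl_nonneg (D := d + 1) (show 0 < μ / 4 by positivity)
  have hB : 0 ≤ Cq * (K * C₂) * Zl (d + 1) (μ / 4) := by positivity
  refine ⟨Cq * (K * C₂) * Zl (d + 1) (μ / 4), μ / 4, hB, by positivity, fun κ u ρ w σ' => ?_⟩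
  set W : Site (d + 1) := ((Lc ^ (m + 2) : ℕ) : ℤ) • w with hW
  have eW : (Lc : ℤ) • (((Lc ^ (m + 1) : ℕ) : ℤ) • w) = W := by rw [hW]; exact smul_pow_succ m w
  have hw : ∀ y, |q σ' y κ u| ≤ Cq * Real.exp (-μ * l1 ((Lc : ℤ) • y - u)) := fun y => by
    rw [l1_sub_symm]
    exact (hq σ' y κ u).trans (mul_le_mul_of_nonneg_left (Real.exp_le_exp.2 (by nlinarith [l1_nonneg (u - (Lc : ℤ) • y)])) hCq)
  have hQ : ∀ y, BiLoc (liftF Lc q (M2Comp Lc q lam H M₂ cΛ (m + 1) σ' y ρ w)) ((Lc : ℤ) • y) ((Lc : ℤ) • y)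
      ((K * C₂) * Real.exp (-μ * l1 ((Lc : ℤ) • y - W))) μ := fun y => by
    have h := hlift (M2Comp Lc q lam H M₂ cΛ (m + 1) σ' y ρ w) y (C₂ * Real.exp (-δ₂ * l1 (y - ((Lc ^ (m + 1) : ℕ) : ℤ) • w))) (hIH σ' y ρ w)
    rw [exp_index_eq (Lc := Lc) δ₂ y, eW] at h
    refine biLoc_le_mono h (by positivity) ?_ hμr
    rw [mul_assoc]
    exact mul_le_mul_of_nonneg_left (mul_le_mul_of_nonneg_left (Real.exp_le_exp.2 (by nlinarith [l1_nonneg ((Lc : ℤ) • y - W)])) hC₂) hK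
  have hKC : 0 ≤ K * C₂ := mul_nonneg hK hC₂
  have h := biLoc_cwsum_farK (N := Lc) (p := u) (P := W) (w := fun v' => q σ' v' κ u)
    (Q := fun v' => liftF Lc q (M2Comp Lc q lam H M₂ cΛ (m + 1) σ' v' ρ w)) hw hQ hμ0 hCq hKC
  exact biLoc_far_mono h hB (l1_nonneg _) (by linarith)

end Families

/-! ## §3 The composite mixed tables are local field–multiplier tables at blocking `Lc^m` -/

section Tables

variable {q : Fin (d + 1) → Site (d + 1) → Fin (d + 1) → Site (d + 1) → ℝ} {Cq δ : ℝ}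
  {H : Fin (d + 1) → Site (d + 1) → MKer (d + 1) (Fib d)} {CH : ℝ}
  {M₂ : Fin (d + 1) → Site (d + 1) → Fin (d + 1) → Site (d + 1) → MKer (d + 1) (Fib d)} {CM : ℝ}

/-- [our object — bookkeeping] **EVERY COMPOSITE MIXED TABLE IS A LOCAL FIELD–MULTIPLIER TABLE AT ITS OWN BLOCKING**: from (Lq), (LH), (LM), for every `m` there are `C`, `δ′ > 0`
with `LocStencilFM (Lc^(m+1)) (M2Comp Lc q λ H M₂ cΛ (m+1)) C δ′` — `BiLoc (M2Comp … (m+1) κ u ρ w) u u (C·e^{−δ′|u − Lc^{m+1}•w|₁}) δ′` uniformly in the two bonds.  Induction over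
the four families of `M2Comp_succ_succ` (§2, fed with FILE D3's `aComp_loc` ∕ `vertexFamily_HComp` and the induction hypothesis), brought to the common rate and assembled by
`biLoc_finset_sum`, `biLoc_smul`, `biLoc_add`.  Discharges nothing by itself. -/
theorem locStencilFM_M2Comp (hq : ∀ ρ w κ u, |q ρ w κ u| ≤ Cq * Real.exp (-δ * l1 (u - (Lc : ℤ) • w))) (hCq : 0 ≤ Cq) (hδ : 0 < δ)
    (hH : VertexFamily H Lc CH δ) (hM₂ : LocStencilFM Lc M₂ CM δ) (lam cΛ : ℝ) :
    ∀ m : ℕ, ∃ C δ' : ℝ, 0 < δ' ∧ LocStencilFM (Lc ^ (m + 1)) (M2Comp Lc q lam H M₂ cΛ (m + 1)) C δ' := by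
  intro m
  induction m with
  | zero =>
    refine ⟨CM, δ, hδ, ?_⟩
    rw [M2Comp_one, show Lc ^ (0 + 1) = Lc by rw [Nat.zero_add, pow_one]]
    exact hM₂
  | succ m ih =>
    obtain ⟨C₂, δ₂, hδ₂, hIH⟩ := ih
    obtain ⟨C₁, δ₁, hδ₁, hX⟩ := vertexFamily_HComp hq hCq hδ hH lam m
    obtain ⟨A, α, hA, hα, ha⟩ := aComp_loc hq hCq hδ lam m
    obtain ⟨B₃, r₃, hB₃, hr₃, h₃⟩ := biLoc_family_hess (lam := lam) hM₂ hδ hA hα ha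
    obtain ⟨B₂, r₂, hB₂, hr₂, h₂⟩ := biLoc_family_weights hq hCq hδ hH hδ₁ hX
    obtain ⟨B₄, r₄, hB₄, hr₄, h₄⟩ := biLoc_family_lin hq hCq hδ hH hδ₁ hX
    obtain ⟨B₁, r₁, hB₁, hr₁, h₁⟩ := biLoc_family_upper (cΛ := cΛ) hq hCq hδ hδ₂ hIH
    set t : ℝ := min (min r₃ r₂) (min r₄ r₁) with ht
    have ht0 : 0 < t := lt_min (lt_min hr₃ hr₂) (lt_min hr₄ hr₁)
    have ht₃ : t ≤ r₃ := (min_le_left _ _).trans (min_le_left _ _)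
    have ht₂ : t ≤ r₂ := (min_le_left _ _).trans (min_le_right _ _)
    have ht₄ : t ≤ r₄ := (min_le_right _ _).trans (min_le_left _ _)
    have ht₁ : t ≤ r₁ := (min_le_right _ _).trans (min_le_right _ _)
    refine ⟨|lam| * ((d + 1 : ℕ) * B₃) + |lam ^ 2 * cΛ| * ((d + 1 : ℕ) * B₂ + B₄) + |lam ^ 3| * ((d + 1 : ℕ) * B₁), t, ht0, fun κ u ρ w => ?_⟩
    rw [show m + 1 + 1 = m + 2 from rfl, M2Comp_succ_succ]
    have hLu : 0 ≤ l1 (u - ((Lc ^ (m + 2) : ℕ) : ℤ) • w) := l1_nonneg _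
    -- all four families at the final rate `t` (in the bi-localisation and in the far factor)
    have h₃' := fun σ : Fin (d + 1) => biLoc_mono (biLoc_far_mono (h₃ κ u ρ w σ) hB₃ hLu ht₃) (mul_nonneg hB₃ (Real.exp_pos _).le) ht₃
    have h₂' := fun σ : Fin (d + 1) => biLoc_mono (biLoc_far_mono (h₂ κ u ρ w σ) hB₂ hLu ht₂) (mul_nonneg hB₂ (Real.exp_pos _).le) ht₂
    have h₄' := biLoc_mono (biLoc_far_mono (h₄ κ u ρ w) hB₄ hLu ht₄) (mul_nonneg hB₄ (Real.exp_pos _).le) ht₄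
    have h₁' := fun σ' : Fin (d + 1) => biLoc_mono (biLoc_far_mono (h₁ κ u ρ w σ') hB₁ hLu ht₁) (mul_nonneg hB₁ (Real.exp_pos _).le) ht₁
    have hS₃ := biLoc_smul lam (biLoc_finset_sum (Finset.univ : Finset (Fin (d + 1))) (fun σ _ => h₃' σ))
    have hS₂₄ := biLoc_smul (lam ^ 2 * cΛ) (biLoc_add (biLoc_finset_sum (Finset.univ : Finset (Fin (d + 1))) (fun σ _ => h₂' σ)) h₄')
    have hS₁ := biLoc_smul (lam ^ 3) (biLoc_finset_sum (Finset.univ : Finset (Fin (d + 1))) (fun σ' _ => h₁' σ'))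
    have hsum := biLoc_add (biLoc_add hS₃ hS₂₄) hS₁
    simp only [Finset.sum_const, Finset.card_univ, Fintype.card_fin, nsmul_eq_mul] at hsum
    refine biLoc_le_mono hsum (hsum.nonneg (Sum.inl 0)) (le_of_eq ?_) le_rfl
    ring

end Tables

end Summit.QuantumFields.BalabanUV.Beta.FP.CompositeAveragingTablesMixedLetters

end
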